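import Mathlib
import Summits.Ventures.HodgeRepro.BallGenCore

/-!
# Lemma W, pointwise core, for every `p` and every `i < p`: continuity and the density step

Blind re-derivation cell `pub-hodge-repro`, seat `typer-2` (gen 3).  `U(p,1)` carries the subspace topology of
`GL_{p+1}(ℂ)` (the `Units` topology), `𝔹^p ⊂ ℂ^p` the subspace topology.  The action `(g, z) ↦ g • z` and the
Jacobian `(g, z) ↦ J_g(z)` are jointly continuous (`continuous_act`, `continuous_Jac`), hence so is the translate
`γ ↦ (γ^*ω)(z)` of a continuous field (`continuous_pullback_left`).  A finite-dimensional subspace `V ⊂ ℂ^p` is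
closed, so `{γ : (γ^*ω)(z) ∉ V}` is open (`isOpen_pullback_not_mem`); it is non-empty by the algebraic core, so a
DENSE subgroup `Δ` meets it.  **`lemmaW_core`**: for `i < p`, `Δ ≤ U(p,1)` dense, `ω` continuous and not
identically zero, and covectors `v : 𝔹^p → (Fin i → ℂ^p)` linearly independent at some point, there are `γ ∈ Δ` and
`z` with `v(z)` linearly independent and `(γ^*ω)(z) ∉ span(v(z))` — i.e. `v₁ ∧ … ∧ v_i ∧ γ^*ω ≠ 0` at `z`.  This is
the pointwise core of ROUTE.md v2.1 Appendix A4 (Lemma W) with `Δ = G(ℚ)`, dense in `G(ℝ) = U(p,1)` by real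
approximation (Milne, *Algebraic Groups*, Thm. 25.70 — printed, not formalised); `p = 2`, `i = 1` is the sealed
statement (c) in this model.
-/

set_option autoImplicit false

noncomputable section

namespace HodgeRepro.BallGen

open Matrix Topology

variable {p : ℕ}

/-! ### Continuity of the action and of the Jacobian -/

/-- `g ↦ mat g` is continuous on `U(p,1)` (subspace topology of `GL`). -/
theorem continuous_mat : Continuous (mat : U p → Matrix (Idx p) (Idx p) ℂ) :=
  Units.continuous_val.comp continuous_subtype_val

/-- `z ↦ z.1` is continuous on the ball. -/
theorem continuous_ball_val : Continuous fun z : Ball p => z.1 :=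
  continuous_subtype_val

/-- The lift `z ↦ (z, 1)` is continuous. -/
theorem continuous_lift : Continuous (lift : Ball p → Idx p → ℂ) := by
  refine continuous_pi fun i => ?_
  rcases i with i | i
  · exact (continuous_apply i).comp continuous_ball_val
  · exact continuous_const

/-- `(g, z) ↦ g · (z, 1)` is jointly continuous. -/
theorem continuous_W : Continuous fun q : U p × Ball p => W q.1 q.2 := by
  unfold W
  exact (continuous_mat.comp continuous_fst).matrix_mulVec (continuous_lift.comp continuous_snd)

/-- The coordinate `(g, z) ↦ (g · (z, 1))_i` is continuous. -/
theorem continuous_W_apply (i : Idx p) : Continuous fun q : U p × Ball p => W q.1 q.2 i :=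
  (continuous_apply i).comp continuous_W

/-- The underlying point of `act g z` is `(w_i / w_last)_i` with `w = g · (z, 1)`. -/
theorem act_val (g : U p) (z : Ball p) : (act g z).1 = fun i => W g z (Sum.inl i) / W g z (last p) := rfl

/-- **The action is jointly continuous.** -/
theorem continuous_act : Continuous fun q : U p × Ball p => act q.1 q.2 := by
  refine continuous_induced_rng.2 ?_
  change Continuous fun q : U p × Ball p => (act q.1 q.2).1
  simp only [act_val]
  refine continuous_pi fun i => ?_
  exact (continuous_W_apply _).div (continuous_W_apply (last p)) fun q => W_last_ne_zero q.1 q.2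

/-- **The Jacobian is jointly continuous.** -/
theorem continuous_Jac : Continuous fun q : U p × Ball p => Jac q.1 q.2 := by
  unfold Jac
  refine continuous_matrix fun i j => ?_
  simp only [Matrix.of_apply]
  have hm : Continuous fun q : U p × Ball p => mat q.1 := continuous_mat.comp continuous_fst
  refine Continuous.div ?_ ((continuous_W_apply (last p)).pow 2)
    fun q => pow_ne_zero 2 (W_last_ne_zero q.1 q.2)
  exact ((hm.matrix_elem _ _).mul (continuous_W_apply (last p))).sub
    ((continuous_W_apply _).mul (hm.matrix_elem _ _))

/-- The translate of a continuous field is jointly continuous in `(γ, z)`. -/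
theorem continuous_pullback {ω : Ball p → Fin p → ℂ} (hω : Continuous ω) :
    Continuous fun q : U p × Ball p => pullback q.1 ω q.2 :=
  continuous_Jac.matrix_transpose.matrix_mulVec (hω.comp continuous_act)

/-- `γ ↦ (γ, z)` is continuous. -/
theorem continuous_pair_const (z : Ball p) : Continuous fun γ : U p => (γ, z) :=
  Continuous.prodMk continuous_id continuous_const

/-- For fixed `z`, `γ ↦ (γ^*ω)(z)` is continuous. -/
theorem continuous_pullback_left {ω : Ball p → Fin p → ℂ} (hω : Continuous ω) (z : Ball p) :
    Continuous fun γ : U p => pullback γ ω z :=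
  Continuous.comp (f := fun γ : U p => (γ, z)) (g := fun q : U p × Ball p => pullback q.1 ω q.2)
    (continuous_pullback hω) (continuous_pair_const z)

/-! ### The density step -/

/-- For fixed `z` and a subspace `V`, the set of `γ` with `(γ^*ω)(z) ∉ V` is open. -/
theorem isOpen_pullback_not_mem {ω : Ball p → Fin p → ℂ} (hω : Continuous ω) (z : Ball p)
    (V : Submodule ℂ (Fin p → ℂ)) : IsOpen {γ : U p | pullback γ ω z ∉ V} := by
  have hV : IsClosed (V : Set (Fin p → ℂ)) := Submodule.closed_of_finiteDimensional V
  exact hV.isOpen_compl.preimage (continuous_pullback_left hω z)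

/-- If some `γ₀` has `(γ₀^*ω)(z) ∉ V`, so does some `γ` in any dense subgroup. -/
theorem exists_mem_pullback_not_mem_of_dense {Δ : Subgroup (U p)} (hΔ : Dense (Δ : Set (U p)))
    {ω : Ball p → Fin p → ℂ} (hω : Continuous ω) (z : Ball p) (V : Submodule ℂ (Fin p → ℂ))
    (h₀ : ∃ γ₀ : U p, pullback γ₀ ω z ∉ V) : ∃ γ ∈ Δ, pullback γ ω z ∉ V := by
  obtain ⟨γ₀, hγ₀⟩ := h₀
  have hopen := isOpen_pullback_not_mem hω z V
  obtain ⟨γ, hγΔ, hγ⟩ := hΔ.exists_mem_open hopen ⟨γ₀, hγ₀⟩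
  exact ⟨γ, hγΔ, hγ⟩

/-- **Lemma W, pointwise core (all `p`, all `i < p`).**  For a dense subgroup `Δ ≤ U(p,1)`, a continuous cotangent
field `ω` that is not identically zero, and covectors `v : 𝔹^p → (Fin i → ℂ^p)` that are linearly independent at some
point, there are `γ ∈ Δ` and `z ∈ 𝔹^p` with `v(z)` linearly independent and `(γ^*ω)(z) ∉ span(v(z))` — that is,
`v₁(z) ∧ … ∧ v_i(z) ∧ (γ^*ω)(z) ≠ 0`. -/
theorem lemmaW_core {i : ℕ} (hi : i < p) {Δ : Subgroup (U p)} (hΔ : Dense (Δ : Set (U p)))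
    (v : Ball p → Fin i → Fin p → ℂ) {ω : Ball p → Fin p → ℂ} (hω : Continuous ω)
    (hv : ∃ z, LinearIndependent ℂ (v z)) (hω0 : ∃ w, ω w ≠ 0) :
    ∃ γ ∈ Δ, ∃ z : Ball p, LinearIndependent ℂ (v z) ∧ pullback γ ω z ∉ Submodule.span ℂ (Set.range (v z)) := by
  obtain ⟨z₁, hz₁⟩ := hv
  obtain ⟨w, hw⟩ := hω0
  obtain ⟨γ, hγΔ, hγ⟩ := exists_mem_pullback_not_mem_of_dense hΔ hω z₁ _
    (exists_pullback_not_mem hi hz₁ z₁ ω hw)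
  exact ⟨γ, hγΔ, z₁, hz₁, hγ⟩

/-- The same with the conclusion spelled as a linearly independent family of `i + 1` covectors
`(v₁(z), …, v_i(z), (γ^*ω)(z))` — the non-vanishing of the `(i+1)`-form `v₁ ∧ … ∧ v_i ∧ γ^*ω` at `z`. -/
theorem lemmaW_core' {i : ℕ} (hi : i < p) {Δ : Subgroup (U p)} (hΔ : Dense (Δ : Set (U p)))
    (v : Ball p → Fin i → Fin p → ℂ) {ω : Ball p → Fin p → ℂ} (hω : Continuous ω)
    (hv : ∃ z, LinearIndependent ℂ (v z)) (hω0 : ∃ w, ω w ≠ 0) :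
    ∃ γ ∈ Δ, ∃ z : Ball p, LinearIndependent ℂ (Fin.snoc (v z) (pullback γ ω z) : Fin (i + 1) → Fin p → ℂ) := by
  obtain ⟨γ, hγΔ, z, hz, hγ⟩ := lemmaW_core hi hΔ v hω hv hω0
  exact ⟨γ, hγΔ, z, linearIndependent_finSnoc.2 ⟨hz, hγ⟩⟩

/-- **Lemma W, iterated (ROUTE.md A4 "Iteration (R5)").**  For `g ≤ p` continuous cotangent fields `ω₁, …, ω_g`,
each non-zero somewhere, and a dense subgroup `Δ ≤ U(p,1)`, there are `γ₁, …, γ_g ∈ Δ` and a point `z` at which the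
translated covectors `(γ₁^*ω₁)(z), …, (γ_g^*ω_g)(z)` are linearly independent — `γ₁^*ω₁ ∧ ⋯ ∧ γ_g^*ω_g ≢ 0`.
(Induction on `g`, each step = `lemmaW_core'` applied to the wedge of the previous translates.) -/
theorem lemmaW_iter {Δ : Subgroup (U p)} (hΔ : Dense (Δ : Set (U p))) :
    ∀ (g : ℕ), g ≤ p → ∀ (ω : Fin g → Ball p → Fin p → ℂ), (∀ j, Continuous (ω j)) → (∀ j, ∃ w, ω j w ≠ 0) →
      ∃ γ : Fin g → U p, (∀ j, γ j ∈ Δ) ∧ ∃ z : Ball p, LinearIndependent ℂ fun j => pullback (γ j) (ω j) z := by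
  intro g
  induction g with
  | zero =>
    intro _ ω _ _
    exact ⟨fun j => Fin.elim0 j, fun j => Fin.elim0 j, center p, linearIndependent_empty_type⟩
  | succ g ih =>
    intro hg ω hω hω0
    obtain ⟨γ, hγΔ, z, hz⟩ := ih (by omega) (fun j => ω (Fin.castSucc j)) (fun j => hω _) (fun j => hω0 _)
    obtain ⟨γ', hγ'Δ, z', hz'⟩ := lemmaW_core' (i := g) (by omega) hΔ
      (fun z j => pullback (γ j) (ω (Fin.castSucc j)) z) (hω (Fin.last g)) ⟨z, hz⟩ (hω0 (Fin.last g))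
    set γn : Fin (g + 1) → U p := Fin.snoc γ γ' with hγn
    refine ⟨γn, ?_, z', ?_⟩
    · intro j
      refine Fin.lastCases ?_ (fun j => ?_) j
      · simpa [hγn] using hγ'Δ
      · simpa [hγn] using hγΔ j
    · have e : (fun j => pullback (γn j) (ω j) z') =
          (Fin.snoc (fun j => pullback (γ j) (ω (Fin.castSucc j)) z') (pullback γ' (ω (Fin.last g)) z') :
            Fin (g + 1) → Fin p → ℂ) := by
        funext j
        refine Fin.lastCases ?_ (fun j => ?_) j
        · simp [hγn]
        · simp [hγn]
      rw [e]
      exact hz'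

/-- **The case `p = 2`, `i = 1`** — the shape of the sealed statement (c) in this model: for a dense `Δ ≤ U(2,1)`,
a continuous `F` and any `G` (continuity of `G` is not needed), both non-zero somewhere, some `γ ∈ Δ` and `z` have
`G(z) ≠ 0` and `(γ^*F)(z) ∉ ℂ·G(z)`, i.e. `(γ^*F)(z) ∧ G(z) ≠ 0`. -/
theorem lemmaW_two {Δ : Subgroup (U 2)} (hΔ : Dense (Δ : Set (U 2))) {F G : Ball 2 → Fin 2 → ℂ}
    (hF : Continuous F) (hF0 : ∃ w, F w ≠ 0) (hG0 : ∃ z, G z ≠ 0) :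
    ∃ γ ∈ Δ, ∃ z : Ball 2, G z ≠ 0 ∧ pullback γ F z ∉ Submodule.span ℂ {G z} := by
  have hv : ∃ z, LinearIndependent ℂ (fun _ : Fin 1 => G z) := by
    obtain ⟨z, hz⟩ := hG0
    exact ⟨z, linearIndependent_unique_iff.2 hz⟩
  obtain ⟨γ, hγΔ, z, hz, hγ⟩ := lemmaW_core (by norm_num) hΔ (fun z (_ : Fin 1) => G z) hF hv hF0
  refine ⟨γ, hγΔ, z, linearIndependent_unique_iff.1 hz, ?_⟩
  simpa [Set.range_const] using hγ

end HodgeRepro.BallGen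

end
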